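import Literature.NumberTheory.EllipticCurves.PAdicOneVariableAffinePushforward
import Literature.NumberTheory.EllipticCurves.PAdicOneVariableUnitsMoments
import HarnessLib

/-!
# The masses of `(a + p·)_* D` and the measures of the series `Σ_a (1+S)^a · R_a((1+S)^p − 1)`
# (de Shalit 1987, I.3.3 (7) ⟺ (7′) in STRUCTURE form; I.3.5 (11) on the units)

De Shalit 1987, I.3.3 (p. 17): "The measure `μ_β` is actually supported on `ℤ_p^×`. This is a
consequence of (7)"; I.3.5 (11) (p. 18): "`∫_G κ(σ)^k dμ_β(σ) = D^k log g_β(0)`".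

Sequel of `PAdicOneVariableAffinePushforward.lean` (`(a + u·)_* D_H = D_{(1+S)^a · H∘[u]}`). The kernel of
the `Ĝ_m`-trace on `𝒪⟦S⟧` is `⊕_{a ∈ (ℤ/p)^×} (1+S)^a · 𝒪⟦(1+S)^p − 1⟧` (at `p = 2`: `(1+S)·𝒪⟦(1+S)²−1⟧`,
tree `LubinTateColemanTraceKernelTwo`); this file reads the measure of such a STRUCTURED series
`H = Σ_{a ∈ s} (1+S)^a · R_a((1+S)^p − 1)` (`s` a finite set of units of `ℤ_p`) off the `R_a`:

* §1 `p_mul_eq_p_mul_iff` (`p·x = p·y` in `ℤ/p^{n+1}` iff `x ≡ y (mod pⁿ)`) and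
  **`affinePush_μ_succ_affineMod`**: `((a + p·)_* D)(a + p b' mod p^{n+1}) = D(b' mod pⁿ)` — the masses of
  the push-forward ON its support (off it they vanish, `affinePush_μ_succ_eq_zero`);
* §2 `invAmice₁_finset_sum_μ` (`D_{Σ P_i} = Σ D_{P_i}` levelwise) and **`invAmice₁_sum_affineSeries_μ_eq_zero_of_not_isUnit`**:
  `D_H` vanishes on the non-unit classes for `H = Σ_{a∈s} (1+S)^a · R_a∘[p]`, `s ⊆ ℤ_p^×`;
* §3 the SOCKET for structured series: **`integral_restrictUnits_density_unitInv_pow_succ_sum_affineSeries`**: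
  `∫ x^{k+1} d(restrictUnits (x⁻¹ · D_H)) = [S^0] D^k H` — de Shalit's (11) for `μ_β♭`, with NO roots of
  unity in the hypotheses (the torsion-free alternative to `PAdicOneVariableTraceCriterion.lean`).

Everything is a theorem; no named facts, no definitions, no instances, no `sorry`.

## References

* [deShalit1987] E. de Shalit, *Iwasawa theory of elliptic curves with complex multiplication* (1987),
  I.3.3 (7)–(8) (p. 17–18), I.3.5 (11) (p. 18).
-/

noncomputable section

open Filter Topology Finset
open scoped fwdDiff Classical

namespace Literature.NumberTheory.EllipticCurves

variable {p : ℕ} [Fact p.Prime]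

/-! ### §1. The masses of `(a + p·)_* D` on its support -/

/-- **`p·x = p·y` in `ℤ/p^{n+1}` iff `x ≡ y (mod pⁿ)`.** [cite: deShalit1987, I.3.3 (7′) (p. 17)] -/
theorem p_mul_eq_p_mul_iff (n : ℕ) (x y : ZMod (p ^ (n + 1))) :
    (p : ZMod (p ^ (n + 1))) * x = (p : ZMod (p ^ (n + 1))) * y ↔
      ZMod.castHom (pow_dvd_pow p n.le_succ) (ZMod (p ^ n)) x =
        ZMod.castHom (pow_dvd_pow p n.le_succ) (ZMod (p ^ n)) y := by
  have hp : p.Prime := Fact.out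
  haveI : NeZero (p ^ (n + 1)) := ⟨pow_ne_zero _ hp.ne_zero⟩
  haveI : NeZero (p ^ n) := ⟨pow_ne_zero _ hp.ne_zero⟩
  rw [ZMod.castHom_apply, ZMod.castHom_apply, ZMod.cast_eq_val, ZMod.cast_eq_val,
    ZMod.natCast_eq_natCast_iff, ← Nat.ModEq.mul_left_cancel_iff' hp.ne_zero (m := p ^ n), ← pow_succ',
    ← ZMod.natCast_eq_natCast_iff, Nat.cast_mul, Nat.cast_mul, ZMod.natCast_zmod_val, ZMod.natCast_zmod_val]

namespace BoundedDistribution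

variable {𝕜 : Type*} [NormedField 𝕜] [IsUltrametricDist 𝕜]
variable (D : BoundedDistribution (ProfiniteTower.padicInt p) 𝕜)

/-- **The masses of `(a + p·)_* D` on its support: `((a + p·)_* D)(a + p b' + p^{n+1}ℤ_p) = D(b' + pⁿℤ_p)`**
(`b'` read modulo `pⁿ`; together with `affinePush_μ_succ_eq_zero` this determines all masses).
[cite: deShalit1987, I.3.3 (7′) (p. 17)] -/
theorem affinePush_μ_succ_affineMod (a : ℤ_[p]) (n : ℕ) (b' : ZMod (p ^ (n + 1))) :
    (D.affinePush a (p : ℤ_[p])).μ (n + 1) (ProfiniteTower.affineMod a (p : ℤ_[p]) (n + 1) b') =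
      D.μ n (ZMod.castHom (pow_dvd_pow p n.le_succ) (ZMod (p ^ n)) b') := by
  rw [affinePush_μ]
  have hfilter : Finset.univ.filter (fun b : ZMod (p ^ (n + 1)) ↦
      PadicInt.toZModPow (n + 1) a + PadicInt.toZModPow (n + 1) (p : ℤ_[p]) * b =
        ProfiniteTower.affineMod a (p : ℤ_[p]) (n + 1) b') =
      Finset.univ.filter (fun b : ZMod (p ^ (n + 1)) ↦ (ProfiniteTower.padicInt p).trans n b =
        ZMod.castHom (pow_dvd_pow p n.le_succ) (ZMod (p ^ n)) b') := by
    ext b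
    simp only [mem_filter, mem_univ, true_and, ProfiniteTower.affineMod_apply, add_right_inj, map_natCast,
      ProfiniteTower.padicInt_trans]
    exact p_mul_eq_p_mul_iff n b b'
  rw [hfilter]
  exact D.sum_fiber n _

end BoundedDistribution

/-! ### §2. The measure of `Σ_a (1+S)^a · R_a∘[p]` is supported on the units -/

section Structure

variable {𝕜 : Type*} [NormedField 𝕜] [NormedAlgebra ℚ_[p] 𝕜] [IsUltrametricDist 𝕜] [CompleteSpace 𝕜]

/-- **The masses of `D_{(1+S)^a · H((1+S)^p − 1)}` on its support**: the class of `a + p b'` modulo `p^{n+1}`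
has mass `D_H(b' + pⁿℤ_p)` (`b'` read modulo `pⁿ`). [cite: deShalit1987, I.3.3 (7′) (p. 17)] -/
theorem invAmice₁_affineSeries_μ_succ_affineMod {H : PowerSeries 𝕜} {C : ℝ}
    (hC : ∀ k, ‖PowerSeries.coeff k H‖ ≤ C) (a : ℤ_[p]) (n : ℕ) (b' : ZMod (p ^ (n + 1))) :
    (invAmice₁ p (affineSeries a (p : ℤ_[p]) H) (norm_coeff_affineSeries_le hC a p)).μ (n + 1)
        (ProfiniteTower.affineMod a (p : ℤ_[p]) (n + 1) b') =
      (invAmice₁ p H hC).μ n (ZMod.castHom (pow_dvd_pow p n.le_succ) (ZMod (p ^ n)) b') := by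
  rw [← affinePush_invAmice₁_μ hC a (p : ℤ_[p]) (n + 1), (invAmice₁ p H hC).affinePush_μ_succ_affineMod a n b']

/-- **`D_{Σ_i P_i} = Σ_i D_{P_i}` levelwise** (finite sums). [cite: deShalit1987, I.3.4 Lemma (i) (p. 18)] -/
theorem invAmice₁_finset_sum_μ {ι : Type*} (s : Finset ι) (P : ι → PowerSeries 𝕜) {C : ι → ℝ} {C' : ℝ}
    (hC : ∀ i, ∀ k, ‖PowerSeries.coeff k (P i)‖ ≤ C i)
    (hC' : ∀ k, ‖PowerSeries.coeff k (∑ i ∈ s, P i)‖ ≤ C') (n : ℕ) (c : ZMod (p ^ n)) :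
    (invAmice₁ p (∑ i ∈ s, P i) hC').μ n c = ∑ i ∈ s, (invAmice₁ p (P i) (hC i)).μ n c := by
  rw [invAmice₁_μ, invAmiceMass₁]
  simp_rw [invAmice₁_μ, invAmiceMass₁]
  rw [← Summable.tsum_finsetSum (fun i _ ↦ summable_invAmiceMass₁ (hC i) n c)]
  exact tsum_congr fun k ↦ by rw [map_sum, sum_mul]

/-- **The measure of a structured series is supported on `ℤ_p^×`**: for a finite set `s` of UNITS `a` of
`ℤ_p` and series `R_a` with a common coefficient bound, the distribution of
`H = Σ_{a∈s} (1+S)^a · R_a((1+S)^p − 1)` vanishes on every non-unit class modulo `p^{n+1}` — the structure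
form of de Shalit's (7) ⟹ "`μ_β` is supported on `ℤ_p^×`" (each summand is `(a + p·)_* D_{R_a}`).
[cite: deShalit1987, I.3.3 (7)–(7′) (p. 17)] -/
theorem invAmice₁_sum_affineSeries_μ_eq_zero_of_not_isUnit (s : Finset ℤ_[p]) (hs : ∀ a ∈ s, IsUnit a)
    (R : ℤ_[p] → PowerSeries 𝕜) {C : ℝ} (hR : ∀ a, ∀ k, ‖PowerSeries.coeff k (R a)‖ ≤ C) {C' : ℝ}
    (hC' : ∀ k, ‖PowerSeries.coeff k (∑ a ∈ s, affineSeries a (p : ℤ_[p]) (R a))‖ ≤ C') (n : ℕ)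
    (c : ZMod (p ^ (n + 1))) (hc : ¬ IsUnit c) :
    (invAmice₁ p (∑ a ∈ s, affineSeries a (p : ℤ_[p]) (R a)) hC').μ (n + 1) c = 0 := by
  rw [invAmice₁_finset_sum_μ s (fun a ↦ affineSeries a (p : ℤ_[p]) (R a))
    (fun a ↦ norm_coeff_affineSeries_le (hR a) a p) hC' (n + 1) c]
  exact sum_eq_zero fun a ha ↦ invAmice₁_affineSeries_μ_eq_zero_of_not_isUnit (hR a) (hs a ha) n c hc

/-! ### §3. The socket for structured series (no roots of unity) -/

/-- **THE SOCKET FOR STRUCTURED SERIES: `∫ x^{k+1} d(restrictUnits (x⁻¹ · D_H)) = [S^0] D^k H`** for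
`H = Σ_{a∈s} (1+S)^a · R_a((1+S)^p − 1)`, `s ⊆ ℤ_p^×` — de Shalit's (11) for `μ_β♭` read through the
structure form of (7) (at `p = 2`: `H = (1+S)·R((1+S)²−1)`), with no roots of unity in the hypotheses.
[cite: deShalit1987, I.3.5 (11) (p. 18), I.3.3 (7)–(8) (p. 17)] -/
theorem integral_restrictUnits_density_unitInv_pow_succ_sum_affineSeries (s : Finset ℤ_[p])
    (hs : ∀ a ∈ s, IsUnit a) (R : ℤ_[p] → PowerSeries 𝕜) {C : ℝ}
    (hR : ∀ a, ∀ k, ‖PowerSeries.coeff k (R a)‖ ≤ C) {C' : ℝ}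
    (hC' : ∀ k, ‖PowerSeries.coeff k (∑ a ∈ s, affineSeries a (p : ℤ_[p]) (R a))‖ ≤ C') (k : ℕ) :
    (restrictUnits ((invAmice₁ p (∑ a ∈ s, affineSeries a (p : ℤ_[p]) (R a)) hC').density
        (ProfiniteTower.padicInt_isUniform p) (unitInv 𝕜) uniformContinuous_unitInv norm_unitInv_le)).integral
        (fun x ↦ padicIntCast 𝕜 (x ^ (k + 1))) =
      PowerSeries.constantCoeff (mahlerD^[k] (∑ a ∈ s, affineSeries a (p : ℤ_[p]) (R a))) :=
  integral_restrictUnits_density_unitInv_pow_succ_eq_constantCoeff hC'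
    (invAmice₁_sum_affineSeries_μ_eq_zero_of_not_isUnit s hs R hR hC') k

/-- **The single-summand case (`p = 2`: `H = (1+S)·R((1+S)²−1)`; generally `H = (1+S)^a · R∘[p]`, `a` a
unit)**: `∫ x^{k+1} d(restrictUnits (x⁻¹ · D_H)) = [S^0] D^k H`. [cite: deShalit1987, I.3.5 (11) (p. 18)] -/
theorem integral_restrictUnits_density_unitInv_pow_succ_affineSeries {H : PowerSeries 𝕜} {C : ℝ}
    (hC : ∀ k, ‖PowerSeries.coeff k H‖ ≤ C) {a : ℤ_[p]} (ha : IsUnit a) (k : ℕ) :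
    (restrictUnits ((invAmice₁ p (affineSeries a (p : ℤ_[p]) H) (norm_coeff_affineSeries_le hC a p)).density
        (ProfiniteTower.padicInt_isUniform p) (unitInv 𝕜) uniformContinuous_unitInv norm_unitInv_le)).integral
        (fun x ↦ padicIntCast 𝕜 (x ^ (k + 1))) =
      PowerSeries.constantCoeff (mahlerD^[k] (affineSeries a (p : ℤ_[p]) H)) :=
  integral_restrictUnits_density_unitInv_pow_succ_eq_constantCoeff (norm_coeff_affineSeries_le hC a p)
    (fun n c hc ↦ invAmice₁_affineSeries_μ_eq_zero_of_not_isUnit hC ha n c hc) k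

/-! ### §4. `binomDilate` is the honest substitution `H((1+S)^u − 1)` -/

omit [IsUltrametricDist 𝕜] [CompleteSpace 𝕜] in
/-- **`H ∘ [u] = H.subst ((1+S)^u − 1)`**: the tree's `binomDilate u H` (defined coefficientwise by finite
sums) IS Mathlib's substitution of the series `(1+S)^u − 1` (no constant term) into `H` — so that
`affineSeries a u H = (1+S)^a · H.subst ((1+S)^u − 1)`; at `p = 2`, `a = 1`, `u = 2`:
`(1+S) · R((1+S)² − 1) = (1+S) · (R ∘ f)` for `f = 2S + S²`, the form of the kernel of Coleman's trace.
[cite: deShalit1987, I.3.2 (5) (p. 17), I.3.3 (7) (p. 17)] -/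
theorem binomDilate_eq_subst (u : ℤ_[p]) (H : PowerSeries 𝕜) :
    binomDilate u H =
      H.subst ((PowerSeries.binomialSeries ℤ_[p] u).map (padicIntCast 𝕜) - 1) := by
  set φ : PowerSeries 𝕜 := (PowerSeries.binomialSeries ℤ_[p] u).map (padicIntCast 𝕜) - 1 with hφ
  have hφ' : φ = ((PowerSeries.binomialSeries ℤ_[p] u) - 1).map (padicIntCast 𝕜) := by
    rw [hφ, map_sub, map_one]
  have hφ0 : PowerSeries.constantCoeff φ = 0 := by
    rw [hφ, map_sub, map_one, sub_eq_zero, ← PowerSeries.coeff_zero_eq_constantCoeff_apply,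
      PowerSeries.coeff_map, coeff_binomialSeries_padicInt, Ring.choose_zero_right, map_one]
  ext j
  rw [coeff_binomDilate, PowerSeries.coeff_subst' (PowerSeries.HasSubst.of_constantCoeff_zero' hφ0),
    finsum_eq_sum_of_support_subset _ (s := Finset.range (j + 1)) ?_]
  · refine Finset.sum_congr rfl fun k _ ↦ ?_
    rw [smul_eq_mul, hφ', ← map_pow, PowerSeries.coeff_map]
  · intro k hk
    rw [Function.mem_support] at hk
    rw [Finset.coe_range, Set.mem_Iio]
    by_contra hkj
    apply hk
    rw [hφ', ← map_pow, PowerSeries.coeff_map, coeff_binomialSeries_sub_one_pow_eq_zero u (by omega),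
      map_zero, smul_zero]

omit [IsUltrametricDist 𝕜] [CompleteSpace 𝕜] in
/-- Hence **`affineSeries a u H = (1+S)^a · H.subst ((1+S)^u − 1)`** with `(1+S)^a = Σ_j (a choose j) S^j`.
[cite: deShalit1987, I.3.2 (5) (p. 17)] -/
theorem affineSeries_eq_mul_subst (a u : ℤ_[p]) (H : PowerSeries 𝕜) :
    affineSeries a u H = (PowerSeries.binomialSeries ℤ_[p] a).map (padicIntCast 𝕜) *
      H.subst ((PowerSeries.binomialSeries ℤ_[p] u).map (padicIntCast 𝕜) - 1) := by
  rw [affineSeries, binomDilate_eq_subst]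

omit [IsUltrametricDist 𝕜] [CompleteSpace 𝕜] in
/-- For natural `a` and `u`: **`affineSeries a u H = (1+S)^a · H.subst ((1+S)^u − 1)`** with honest powers of
`1 + S` (e.g. `p = 2`, `a = 1`, `u = 2`: `(1+S) · H(2S + S²)`). [cite: deShalit1987, I.3.3 (7) (p. 17)] -/
theorem affineSeries_natCast_eq (a u : ℕ) (H : PowerSeries 𝕜) :
    affineSeries (a : ℤ_[p]) (u : ℤ_[p]) H =
      (1 + PowerSeries.X) ^ a * H.subst ((1 + PowerSeries.X : PowerSeries 𝕜) ^ u - 1) := by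
  rw [affineSeries_eq_mul_subst, PowerSeries.binomialSeries_nat, PowerSeries.binomialSeries_nat, map_pow,
    map_pow, map_add, map_one, PowerSeries.map_X]

end Structure

end Literature.NumberTheory.EllipticCurves

end
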